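import Summits.PneNP.PneNP.Theorems.ConvexRankGatesConvexGateBlindExactLiftingStrictLimit

/-!
# Uniqueness + isolation of the minimal factorisation ⇒ an ε-uniform strict-rank jump (abstract form)

Support file for crux `ConvexGateBlind` (stmt-PneNP-10680), open stub `stub_exactLifting` (prover seat 0, session 28,
memo ANALYSIS13 §2). The abstract engine behind `…TriangleJump`, stated for an ARBITRARY real matrix `m` on finite
index types so that other instances of the stub (K₄, single-equation lifts, …) can reuse it without redoing the
compactness argument. Data: a reference family of rank-one terms `P i x w` (think: the terms of the conjecturally unique
minimal non-negative factorisation of `m`), indexed by the finite type `ι`. Hypotheses: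
 * UNIQUENESS — every non-negative factorisation of `m` indexed by `ι` has, up to a permutation of `ι`, exactly the terms `P`;
 * ISOLATION — for some `δ > 0`, every non-negative factorisation of a shifted matrix `m − ε` indexed by `ι` whose terms are
   entrywise `δ`-close to the reference terms has `ε ≤ 0` (for the triangle matrix this is Theorem B after renormalisation).
Conclusion (`jump_of_unique_isolated`): there is `ε₀ > 0` such that for `0 < ε < ε₀` the matrix `m − ε` has NO non-negative
factorisation indexed by `ι` — in rank language `rk₊(m − εJ) ≥ #ι + 1` near `0⁺` whenever `#ι = rk₊(m)`, the minimal
factorisation is unique and isolated from strict ones. Proof: limits of strict factorisations (`exists_limit_nmf`) are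
factorisations of `m`, hence the reference one up to relabelling, with termwise convergence — contradicting isolation.
Registered sub-goal `strict_jump_of_unique_isolated` (Mathlib-only signature).
-/

set_option linter.dupNamespace false -- `Summit.PneNP.PneNP.…`: summit = sub-problem (D-0017)

namespace Summit.PneNP.PneNP.Theorems.XorDoor

open Filter Topology Finset

/-- **Uniqueness + isolation ⇒ ε-uniform jump** (abstract). See the module docstring. -/
theorem jump_of_unique_isolated {ι X W : Type} [Fintype ι] [Fintype X] [Fintype W] (m : X → W → ℝ)
    (P : ι → X → W → ℝ)
    (huniq : ∀ (u : ι → X → ℝ) (v : ι → W → ℝ), (∀ i x, 0 ≤ u i x) → (∀ i w, 0 ≤ v i w) →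
      (∀ x w, ∑ i, u i x * v i w = m x w) → ∃ σ : Equiv.Perm ι, ∀ i x w, u i x * v i w = P (σ i) x w)
    (hiso : ∃ δ : ℝ, 0 < δ ∧ ∀ (ε : ℝ) (u : ι → X → ℝ) (v : ι → W → ℝ), (∀ i x, 0 ≤ u i x) → (∀ i w, 0 ≤ v i w) →
      (∀ x w, ∑ i, u i x * v i w = m x w - ε) → (∀ i x w, |u i x * v i w - P i x w| < δ) → ε ≤ 0) :
    ∃ ε₀ : ℝ, 0 < ε₀ ∧ ∀ ε : ℝ, 0 < ε → ε < ε₀ → ∀ (u : ι → X → ℝ) (v : ι → W → ℝ),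
      (∀ i x, 0 ≤ u i x) → (∀ i w, 0 ≤ v i w) → ¬ ∀ x w, ∑ i, u i x * v i w = m x w - ε := by
  classical
  obtain ⟨δ, hδ, hiso⟩ := hiso
  by_contra hcon
  push Not at hcon
  -- a sequence of strict factorisations with shifts `ε n ∈ (0, 1/(n+1))`
  have hseq : ∀ n : ℕ, ∃ ε : ℝ, 0 < ε ∧ ε < 1 / ((n : ℝ) + 1) ∧ ∃ (u : ι → X → ℝ) (v : ι → W → ℝ),
      (∀ i x, 0 ≤ u i x) ∧ (∀ i w, 0 ≤ v i w) ∧ ∀ x w, ∑ i, u i x * v i w = m x w - ε := by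
    intro n
    obtain ⟨ε, hε0, hε1, u, v, hu, hv, hf⟩ := hcon (1 / ((n : ℝ) + 1)) (by positivity)
    exact ⟨ε, hε0, hε1, u, v, hu, hv, hf⟩
  choose ε hε0 hε1 u v hu hv hf using hseq
  have hεlim : Tendsto ε atTop (𝓝 0) := by
    refine squeeze_zero (fun n => (hε0 n).le) (fun n => (hε1 n).le) ?_
    exact tendsto_one_div_add_atTop_nhds_zero_nat
  -- the limit factorisation of `m` and termwise convergence along a subsequence
  obtain ⟨u₀, v₀, hu₀, hv₀, hf₀, φ, hφ, hterm⟩ := exists_limit_nmf m ε hεlim u v hu hv hf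
  -- uniqueness: the limit terms are the reference terms up to `σ`
  obtain ⟨σ, hσ⟩ := huniq u₀ v₀ hu₀ hv₀ hf₀
  set τ := σ.symm with hτ
  have hστ : ∀ i, σ (τ i) = i := fun i => σ.apply_symm_apply i
  have hterm' : ∀ i x w, Tendsto (fun n => u (φ n) (τ i) x * v (φ n) (τ i) w) atTop (𝓝 (P i x w)) := by
    intro i x w
    have := hterm (τ i) x w
    rwa [hσ (τ i) x w, hστ] at this
  -- eventually every relabelled term is `δ`-close to its reference term
  have hev : ∀ᶠ n in atTop, ∀ i x w, |u (φ n) (τ i) x * v (φ n) (τ i) w - P i x w| < δ := by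
    refine eventually_all.2 fun i => eventually_all.2 fun x => eventually_all.2 fun w => ?_
    have := Metric.tendsto_nhds.1 (hterm' i x w) δ hδ
    simpa only [Real.dist_eq] using this
  obtain ⟨n, hn⟩ := hev.exists
  -- the relabelled factorisation at stage `n` contradicts isolation
  have hfact : ∀ x w, ∑ i, u (φ n) (τ i) x * v (φ n) (τ i) w = m x w - ε (φ n) := by
    intro x w
    rw [← hf (φ n) x w]
    exact Equiv.sum_comp τ (fun i => u (φ n) i x * v (φ n) i w)
  have := hiso (ε (φ n)) (fun i => u (φ n) (τ i)) (fun i => v (φ n) (τ i)) (fun i x => hu _ _ _)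
    (fun i w => hv _ _ _) hfact hn
  linarith [hε0 (φ n)]

/-- **Uniqueness + isolation ⇒ ε-uniform strict-rank jump, registered form** (sub-goal
`strict_jump_of_unique_isolated` of stmt-PneNP-10680, verbatim signature; Mathlib vocabulary only). -/
theorem strict_jump_of_unique_isolated : ∀ (ι X W : Type) [Fintype ι] [Fintype X] [Fintype W] (m : X → W → ℝ)
    (P : ι → X → W → ℝ), (∀ (u : ι → X → ℝ) (v : ι → W → ℝ), (∀ i x, 0 ≤ u i x) → (∀ i w, 0 ≤ v i w) → (∀ x w, ∑ i,
    u i x * v i w = m x w) → ∃ σ : Equiv.Perm ι, ∀ i x w, u i x * v i w = P (σ i) x w) → (∃ δ : ℝ, 0 < δ ∧ ∀ (ε : ℝ)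
    (u : ι → X → ℝ) (v : ι → W → ℝ), (∀ i x, 0 ≤ u i x) → (∀ i w, 0 ≤ v i w) → (∀ x w, ∑ i, u i x * v i w = m x w -
    ε) → (∀ i x w, |u i x * v i w - P i x w| < δ) → ε ≤ 0) → ∃ ε₀ : ℝ, 0 < ε₀ ∧ ∀ ε : ℝ, 0 < ε → ε < ε₀ → ∀ (u : ι
    → X → ℝ) (v : ι → W → ℝ), (∀ i x, 0 ≤ u i x) → (∀ i w, 0 ≤ v i w) → ¬ ∀ x w, ∑ i, u i x * v i w = m x w - ε :=
  fun _ _ _ _ _ _ m P huniq hiso => jump_of_unique_isolated m P huniq hiso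

end Summit.PneNP.PneNP.Theorems.XorDoor
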